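import Literature.NumberTheory.LFunctions.SiegelWalfiszLiouville
import Literature.NumberTheory.LFunctions.SiegelWalfiszMoebiusProofs
import HarnessLib

/-!
# Crux `MobiusLadder.LiouvilleOrthogonalTC0` (stmt-QuantumAdvantage-1393), line `Sketch`,
# skeleton v10: stub `stub_periodic` (the periodic rung)

For every `A : ℕ` and every `ε > 0`, eventually in `n`: for all moduli `1 ≤ q ≤ n ^ A` and every
`1`-bounded weight `g : ℕ → ℝ`,
`|Σ_{N < 2^n} λ(N) g(N mod q)| ≤ ε 2^n`.

This is UNCONDITIONAL: a direct corollary of the tree's PROVED Siegel–Walfisz theorem for the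
Liouville function in arithmetic progressions,
`SiegelWalfiszMoebius_holds.liouville_progression` (Montgomery–Vaughan, *Multiplicative Number
Theory I*, §11.3), in the `(log x)^{-B}` currency.

Naming: the declarations live in the sub-namespace `…Theorems.LiouvilleOrthogonalTC0.PeriodicRung`
(main theorem `PeriodicRung.stub_periodic`, helpers `PeriodicRung.StubPeriodic.*`), because the names
`…Theorems.LiouvilleOrthogonalTC0.stub_periodic` / `….StubPeriodic.*` are already taken in the tree by
the earlier, differently quantified periodic rung of
`MobiusLadderLiouvilleOrthogonalTC0StubPeriodic.lean` (`∃ C, ∀ n ≥ 2, … ≤ C q 2ⁿ / n^B`); the tree is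
append-only.

## Proof

* Regroup `Σ_{N < 2^n}` by residues `a (mod q)` (`StubPeriodic.sum_range_eq_sum_residues`); the term
  `N = 0` is dropped since `λ(0) = 0`, so every class sum is a sum over
  `{1 ≤ N ≤ ⌊x⌋₊ : N ≡ a (q)}` with `x = 2^n - 1`.
* Each class sum is at most `C x / (log x)^{A+1}` as soon as `q ≤ (log x)^{A+1}`
  (`liouville_progression` with both exponents equal to `A + 1`), whence
  `|Σ| ≤ q · C x/(log x)^{A+1} ≤ n^A C 2^n/(log x)^{A+1}`.
* Numerics: `log x ≥ (log 2 / 2) n` for `n ≥ 2` (`StubPeriodic.log_lower`), so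
  `n^A (C/ε + 1) ≤ (log x)^{A+1}` as soon as `n ≥ (C/ε + 1)/(log 2 / 2)^{A+1}`
  (`StubPeriodic.pow_mul_le_pow_succ`); this gives both the admissibility `n^A ≤ (log x)^{A+1}` and
  the final bound `n^A C x/(log x)^{A+1} ≤ ε x ≤ ε 2^n`.
-/

set_option linter.dupNamespace false -- D-0017: single-problem summit ⇒ QuantumAdvantage.QuantumAdvantage by design

noncomputable section

namespace Summit.QuantumAdvantage.QuantumAdvantage.Theorems.LiouvilleOrthogonalTC0

namespace PeriodicRung

open Filter Finset ArithmeticFunction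
open Literature.NumberTheory.LFunctions

namespace StubPeriodic

/-- `λ(0) = 0`, so a `λ`-weighted sum over `N < 2^n` equals the sum over `1 ≤ N ≤ 2^n - 1`. -/
theorem sum_range_eq_sum_Icc (n : ℕ) (F : ℕ → ℝ) :
    ∑ N ∈ range (2 ^ n), (liouville N : ℝ) * F N =
      ∑ N ∈ Icc 1 (2 ^ n - 1), (liouville N : ℝ) * F N := by
  symm
  refine Finset.sum_subset (fun N hN => ?_) (fun N hN hN' => ?_)
  · rw [mem_Icc] at hN
    rw [mem_range]
    omega
  · have h0 : N = 0 := by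
      rw [mem_range] at hN
      rw [mem_Icc] at hN'
      omega
    subst h0
    simp

/-- Regrouping by residues: for `q ≥ 1`,
`Σ_{N < 2^n} λ(N) g(N mod q) = Σ_{a < q} g(a) Σ_{1 ≤ N ≤ 2^n - 1, N ≡ a (q)} λ(N)`. -/
theorem sum_range_eq_sum_residues (n : ℕ) {q : ℕ} (hq : 1 ≤ q) (g : ℕ → ℝ) :
    ∑ N ∈ range (2 ^ n), (liouville N : ℝ) * g (N % q) =
      ∑ a ∈ range q, g a *
        ∑ N ∈ (Icc 1 (2 ^ n - 1)).filter (fun N : ℕ => (N : ZMod q) = a), (liouville N : ℝ) := by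
  rw [sum_range_eq_sum_Icc, ← Finset.sum_fiberwise_of_maps_to (g := fun N : ℕ => N % q)
    (t := range q) (fun N _ => mem_range.2 (Nat.mod_lt N (by omega)))]
  refine Finset.sum_congr rfl (fun a ha => ?_)
  have haq : a % q = a := Nat.mod_eq_of_lt (mem_range.1 ha)
  rw [Finset.mul_sum]
  refine Finset.sum_congr (Finset.filter_congr (fun N _ => ?_)) (fun N hN => ?_)
  · simp only [ZMod.natCast_eq_natCast_iff', haq]
  · obtain ⟨-, hN⟩ := Finset.mem_filter.1 hN
    rw [ZMod.natCast_eq_natCast_iff', haq] at hN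
    rw [hN, mul_comm]

/-- `|Σ_{a < q} g(a) F(a)| ≤ q B` when `|g| ≤ 1` and `|F(a)| ≤ B` for `a < q`. -/
theorem abs_sum_mul_le {q : ℕ} {g F : ℕ → ℝ} {B : ℝ} (hg : ∀ a, |g a| ≤ 1)
    (hF : ∀ a ∈ range q, |F a| ≤ B) :
    |∑ a ∈ range q, g a * F a| ≤ q * B := by
  calc |∑ a ∈ range q, g a * F a| ≤ ∑ a ∈ range q, |g a * F a| :=
        Finset.abs_sum_le_sum_abs _ _
    _ ≤ ∑ a ∈ range q, B := Finset.sum_le_sum (fun a ha => by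
        rw [abs_mul]
        calc |g a| * |F a| ≤ 1 * B := mul_le_mul (hg a) (hF a ha) (abs_nonneg _) zero_le_one
          _ = B := one_mul B)
    _ = q * B := by rw [Finset.sum_const, Finset.card_range, nsmul_eq_mul]

/-- For `n ≥ 2`, `2 ≤ 2^n - 1` (as reals). -/
theorem two_le_cast {n : ℕ} (hn : 2 ≤ n) : (2 : ℝ) ≤ ((2 ^ n - 1 : ℕ) : ℝ) := by
  have h4 : 4 ≤ 2 ^ n :=
    calc 4 = 2 ^ 2 := by norm_num
      _ ≤ 2 ^ n := Nat.pow_le_pow_right (by norm_num) hn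
  have h : (2 : ℕ) ≤ 2 ^ n - 1 := by omega
  exact_mod_cast h

/-- `2^n - 1 ≤ 2^n` (as reals). -/
theorem cast_le_two_pow (n : ℕ) : ((2 ^ n - 1 : ℕ) : ℝ) ≤ 2 ^ n := by
  exact_mod_cast Nat.sub_le (2 ^ n) 1

/-- For `n ≥ 2`: `(log 2 / 2) n ≤ log (2^n - 1)`, because `2^{n-1} ≤ 2^n - 1` and `n / 2 ≤ n - 1`. -/
theorem log_lower {n : ℕ} (hn : 2 ≤ n) :
    Real.log 2 / 2 * n ≤ Real.log ((2 ^ n - 1 : ℕ) : ℝ) := by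
  obtain ⟨m, rfl⟩ : ∃ m, n = m + 2 := ⟨n - 2, by omega⟩
  have hlog2 : 0 < Real.log 2 := Real.log_pos one_lt_two
  have hpow : (2 : ℝ) ^ (m + 1) ≤ ((2 ^ (m + 2) - 1 : ℕ) : ℝ) := by
    have h1 : 2 ^ (m + 1) ≤ 2 ^ (m + 2) - 1 := by
      have h2 : 2 ^ (m + 2) = 2 ^ (m + 1) * 2 := by ring
      have h3 := Nat.one_le_two_pow (n := m + 1)
      omega
    exact_mod_cast h1
  have hm : (0 : ℝ) ≤ (m : ℝ) * Real.log 2 := mul_nonneg m.cast_nonneg hlog2.le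
  calc Real.log 2 / 2 * ((m + 2 : ℕ) : ℝ) ≤ ((m + 1 : ℕ) : ℝ) * Real.log 2 := by
        push_cast
        linarith
    _ = Real.log ((2 : ℝ) ^ (m + 1)) := (Real.log_pow _ _).symm
    _ ≤ Real.log ((2 ^ (m + 2) - 1 : ℕ) : ℝ) := Real.log_le_log (by positivity) hpow

/-- The final numeric inequality: if `M / c^{A+1} ≤ n` and `c n ≤ L` (`c > 0`, `n ≥ 0`),
then `n^A M ≤ L^{A+1}`. -/
theorem pow_mul_le_pow_succ {A : ℕ} {M c n L : ℝ} (hc : 0 < c)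
    (hn : M / c ^ (A + 1) ≤ n) (hL : c * n ≤ L) (hn0 : 0 ≤ n) :
    n ^ A * M ≤ L ^ (A + 1) := by
  have hcA : 0 < c ^ (A + 1) := pow_pos hc _
  have hMn : M ≤ c ^ (A + 1) * n := by
    rw [div_le_iff₀ hcA] at hn
    linarith [mul_comm n (c ^ (A + 1))]
  have hcn : 0 ≤ c * n := mul_nonneg hc.le hn0
  calc n ^ A * M ≤ n ^ A * (c ^ (A + 1) * n) := mul_le_mul_of_nonneg_left hMn (pow_nonneg hn0 _)
    _ = (c * n) ^ (A + 1) := by ring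
    _ ≤ L ^ (A + 1) := pow_le_pow_left₀ hcn hL _

end StubPeriodic

/-- **Stub `stub_periodic` (the periodic rung, unconditional).** For every `A : ℕ` and `ε > 0`,
eventually in `n`: for all moduli `1 ≤ q ≤ n^A` and every `1`-bounded `g : ℕ → ℝ`,
`|Σ_{N < 2^n} λ(N) g(N mod q)| ≤ ε 2^n`. Regrouping by residues `a (mod q)`, each class sum over
`1 ≤ N ≤ 2^n - 1` is `≤ C x/(log x)^{A+1}` (`x = 2^n - 1`) by the tree's PROVED Siegel–Walfisz
theorem for `λ` in progressions `SiegelWalfiszMoebius_holds.liouville_progression` (admissible since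
`q ≤ n^A ≤ (log x)^{A+1}` for large `n`), and `q · C x/(log x)^{A+1} ≤ n^A C 2^n/(log x)^{A+1} ≤ ε 2^n`
eventually, because `log x ≥ (log 2 / 2) n`. -/
theorem stub_periodic (A : ℕ) : ∀ ε : ℝ, 0 < ε → ∀ᶠ n : ℕ in atTop, ∀ q : ℕ, 1 ≤ q → q ≤ n ^ A →
    ∀ g : ℕ → ℝ, (∀ a, |g a| ≤ 1) →
      |∑ N ∈ Finset.range (2 ^ n), (ArithmeticFunction.liouville N : ℝ) * g (N % q)| ≤ ε * 2 ^ n := by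
  intro ε hε
  obtain ⟨C, hC⟩ := SiegelWalfiszMoebius_holds.liouville_progression (A := ((A + 1 : ℕ) : ℝ))
    (Nat.cast_pos.2 (Nat.succ_pos A)) ((A + 1 : ℕ) : ℝ)
  simp only [Real.rpow_natCast] at hC
  have hlog2 : 0 < Real.log 2 := Real.log_pos one_lt_two
  have hc0 : 0 < Real.log 2 / 2 := by positivity
  have hC'0 : 0 ≤ max C 1 := zero_le_one.trans (le_max_right _ _)
  filter_upwards [eventually_ge_atTop 2, tendsto_natCast_atTop_atTop.eventually_ge_atTop
    ((max C 1 / ε + 1) / (Real.log 2 / 2) ^ (A + 1))] with n hn2 hnM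
  intro q hq1 hqA g hg
  -- facts about the real point `x = 2^n - 1`
  have hx2 : (2 : ℝ) ≤ ((2 ^ n - 1 : ℕ) : ℝ) := StubPeriodic.two_le_cast hn2
  have hx0 : (0 : ℝ) ≤ ((2 ^ n - 1 : ℕ) : ℝ) := Nat.cast_nonneg _
  have hxle : ((2 ^ n - 1 : ℕ) : ℝ) ≤ 2 ^ n := StubPeriodic.cast_le_two_pow n
  have hL : Real.log 2 / 2 * n ≤ Real.log ((2 ^ n - 1 : ℕ) : ℝ) := StubPeriodic.log_lower hn2
  have hLpos : 0 < Real.log ((2 ^ n - 1 : ℕ) : ℝ) :=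
    lt_of_lt_of_le (mul_pos hc0 (by exact_mod_cast (by omega : 0 < n))) hL
  have hkey : (n : ℝ) ^ A * (max C 1 / ε + 1) ≤ Real.log ((2 ^ n - 1 : ℕ) : ℝ) ^ (A + 1) :=
    StubPeriodic.pow_mul_le_pow_succ hc0 hnM hL (Nat.cast_nonneg n)
  have hnA0 : (0 : ℝ) ≤ (n : ℝ) ^ A := by positivity
  have hqA' : (q : ℝ) ≤ (n : ℝ) ^ A := by exact_mod_cast hqA
  -- admissibility of the modulus: `q ≤ n^A ≤ (log x)^{A+1}`
  have hadm : (q : ℝ) ≤ Real.log ((2 ^ n - 1 : ℕ) : ℝ) ^ (A + 1) :=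
    hqA'.trans ((le_mul_of_one_le_right hnA0 (le_add_of_nonneg_left (by positivity))).trans hkey)
  -- the loss: `n^A · C ≤ ε (log x)^{A+1}`
  have hB : (n : ℝ) ^ A * max C 1 ≤ ε * Real.log ((2 ^ n - 1 : ℕ) : ℝ) ^ (A + 1) := by
    have h : (n : ℝ) ^ A * (max C 1 / ε) ≤ Real.log ((2 ^ n - 1 : ℕ) : ℝ) ^ (A + 1) :=
      (mul_le_mul_of_nonneg_left (le_add_of_nonneg_right zero_le_one) hnA0).trans hkey
    rw [← mul_div_assoc, div_le_iff₀ hε] at h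
    linarith
  -- Siegel–Walfisz in every residue class
  have hSW : ∀ a ∈ range q,
      |∑ N ∈ (Icc 1 (2 ^ n - 1)).filter (fun N : ℕ => (N : ZMod q) = a), (liouville N : ℝ)| ≤
        max C 1 * ((2 ^ n - 1 : ℕ) : ℝ) / Real.log ((2 ^ n - 1 : ℕ) : ℝ) ^ (A + 1) := by
    intro a _
    have h := hC _ hx2 q hq1 hadm (a : ZMod q)
    rw [Nat.floor_natCast] at h
    exact h.trans (div_le_div_of_nonneg_right
      (mul_le_mul_of_nonneg_right (le_max_left _ _) hx0) (pow_nonneg hLpos.le _))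
  rw [StubPeriodic.sum_range_eq_sum_residues n hq1 g]
  refine (StubPeriodic.abs_sum_mul_le hg hSW).trans ?_
  have hLne : Real.log ((2 ^ n - 1 : ℕ) : ℝ) ^ (A + 1) ≠ 0 := pow_ne_zero _ hLpos.ne'
  calc (q : ℝ) * (max C 1 * ((2 ^ n - 1 : ℕ) : ℝ) / Real.log ((2 ^ n - 1 : ℕ) : ℝ) ^ (A + 1))
      ≤ (n : ℝ) ^ A * (max C 1 * ((2 ^ n - 1 : ℕ) : ℝ) / Real.log ((2 ^ n - 1 : ℕ) : ℝ) ^ (A + 1)) :=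
        mul_le_mul_of_nonneg_right hqA' (div_nonneg (mul_nonneg hC'0 hx0) (pow_nonneg hLpos.le _))
    _ = (n : ℝ) ^ A * max C 1 * ((2 ^ n - 1 : ℕ) : ℝ) / Real.log ((2 ^ n - 1 : ℕ) : ℝ) ^ (A + 1) := by
        ring
    _ ≤ ε * Real.log ((2 ^ n - 1 : ℕ) : ℝ) ^ (A + 1) * ((2 ^ n - 1 : ℕ) : ℝ) /
          Real.log ((2 ^ n - 1 : ℕ) : ℝ) ^ (A + 1) :=
        div_le_div_of_nonneg_right (mul_le_mul_of_nonneg_right hB hx0) (pow_nonneg hLpos.le _)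
    _ = ε * ((2 ^ n - 1 : ℕ) : ℝ) := by
        rw [mul_right_comm, mul_div_assoc, div_self hLne, mul_one]
    _ ≤ ε * 2 ^ n := mul_le_mul_of_nonneg_left hxle hε.le

end PeriodicRung

end Summit.QuantumAdvantage.QuantumAdvantage.Theorems.LiouvilleOrthogonalTC0

end
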